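import Summits.BirchSwinnertonDyer.Rank1Residual.ManinAdditive.ShimuraCoverMuThree
import Summits.BirchSwinnertonDyer.BirchSwinnertonDyer.Theorems.ManinLocalTwoThreeCuspZeroAnnihilatorOfCuspGalois
import HarnessLib

/-!
# The Shimura cover has CONSTANT kernel — PROVED edges (cone sibling of `ShimuraCoverMuThree.lean`)
(cell `bsd-f2-manin`, an g41 FILE K sha16 2dc0c7cd24ba1a62, MEMO-an §86.11; typer g21 T-an-57 SPLIT BY IMPORT CONE)

This sibling holds, VERBATIM from an's FILE K, the six PROVED theorems that need the `Theses.ManinLocalTwoThree` import cone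
(`Theorems.ManinLocalTwoThreeCuspZeroAnnihilatorOfCuspGalois`: `c_mul_mem_lattice_iff_of_isOptimal`, `gamma1_uniformize_eq_zero_iff`,
`shimuraThreeForcesRationalThreeTorsion_of_cuspGalois`): §1 `exists_addOrderOf_eq_of_mem_periodLattice`,
`exists_addOrderOf_eq_of_not_shimuraIndexPrimeTo` (E-an-235b ⟸ F★), `shimuraKernelForcesClassTorsion_of_cuspRational` (**E-an-235 ⟸ F★ ∧ CES**),
§3 `shimuraThreeKernelHasMuThree_of_cover` (**E-an-225 ⟸ F★ ∧ CES ∧ E-an-234**), §4 `shimuraThreeKernelForcesTwentySevenOpt_of_cover`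
(**E-an-222ₒ ⟸ E-an-223 ∧ E-an-234 ∧ F★₀ ∧ F★ ∧ F♮ ∧ CES**), `plusIndexPrimeToThreeOfNoMuThree_of_cover` (E-es-67♮ ⟸ F★ ∧ CES ∧ E-an-234).
The nodes E-an-235 / E-an-234 and the cone-free `exists_rational_eq_uniformize_of_mem_periodLattice` live in the route-independent leaf
`ShimuraCoverMuThree.lean` (its module docstring has an's full mathematics, the paper proof of E-an-234 and the honest framing).  Same
namespace.  Theorem-only (kind proof); no new definitions; no sorry; axioms standard.  bears_on: stmt-BirchSwinnertonDyer-22968 (C3).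
C3 is NOT proved by this; BSD is not proved by this.
[cite: Vatsal2005, Rem. 1.8] [cite: ConradEdixhovenStein2003, Thm. 1.1.3, §6.1.2, §6.2] [cite: Stevens1989, §2] [cite: Stevens1982, Thm. 1.3.1]
-/


set_option autoImplicit false

open scoped Classical MatrixGroups ModularForm
open CongruenceSubgroup WeierstrassCurve Literature.NumberTheory.EllipticCurves Literature.NumberTheory.EllipticCurves.ModularForms
open Summit.BirchSwinnertonDyer.Rank1Residual.ManinAdditive.KatoCurve
open Summit.BirchSwinnertonDyer.Rank1Residual.ManinAdditive.HesseOptimality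
open Summit.BirchSwinnertonDyer.BirchSwinnertonDyer.Theorems.ManinLocalTwoThree
open Summit.BirchSwinnertonDyer.BirchSwinnertonDyer.Theorems.ManinLocalTwoThree.CuspGalois

namespace Summit.BirchSwinnertonDyer.Rank1Residual.ManinAdditive.ShimuraCover

/-! ### §1. E-an-235 (PROVED ⟸ F★): the kernel of the Shimura cover is constant — every point `u₁(c₁x)`, `x ∈ Λ₀(f)`, of Stevens'
curve is rational; a Shimura `p`-kernel puts a rational point of order `p` on Stevens' curve -/

section StevensCurve

variable {W₁ : WeierstrassCurve ℚ} [W₁.IsElliptic] {N : ℕ} [NeZero N]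

/-- **A Shimura `p`-kernel point is a rational point of order `p` on Stevens' curve (E-an-235b, PROVED ⟸ F★).**  If
`x ∈ Λ₀(f)`, `p·x ∈ Λ₁(f)`, `x ∉ Λ₁(f)` for an optimal `X₁(N)`-datum `D₁` of `W₁`, then `W₁(ℚ)` has a point of order exactly `p`
(namely the rational point under `u₁(c₁x)`: `p • u₁(c₁x) = u₁(c₁·px) = O` as `c₁Λ₁(f) ⊆ Λ_{W₁}`, and `u₁(c₁x) ≠ O` as
`c₁x ∈ Λ_{W₁} = c₁Λ₁(f)` would give `x ∈ Λ₁(f)`). [cite: Vatsal2005, Rem. 1.8] [cite: Stevens1989, §2] -/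
theorem exists_addOrderOf_eq_of_mem_periodLattice (hF : optimalGamma1Parametrization_cusp_rational)
    (D₁ : Gamma1ParametrizationData W₁ N) (hD₁ : D₁.IsOptimal) {p : ℕ} (hp : p.Prime) {x : ℂ} (hx : x ∈ periodLattice D₁.f)
    (hpx : (p : ℂ) * x ∈ periodLatticeGamma1 D₁.f) (hx₁ : x ∉ periodLatticeGamma1 D₁.f) :
    ∃ P : (W₁.baseChange ℚ).toAffine.Point,
      Affine.Point.baseChange (W' := W₁) ℚ ℂ P = D₁.uniformize ((D₁.c : ℂ) * x) ∧ addOrderOf P = p := by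
  obtain ⟨P, hP⟩ := exists_rational_eq_uniformize_of_mem_periodLattice hF D₁ hD₁ hx
  haveI : Fact p.Prime := ⟨hp⟩
  set ι := Affine.Point.baseChange (W' := W₁) ℚ ℂ with hι
  have hιinj : Function.Injective ι := Affine.Point.map_injective _
  refine ⟨P, hP, addOrderOf_eq_prime ?_ ?_⟩
  · apply hιinj
    rw [map_nsmul, map_zero, hP, ← map_nsmul, nsmul_eq_mul, gamma1_uniformize_eq_zero_iff,
      show (p : ℂ) * ((D₁.c : ℂ) * x) = (D₁.c : ℂ) * ((p : ℂ) * x) by ring, c_mul_mem_lattice_iff_of_isOptimal D₁ hD₁]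
    exact hpx
  · rintro rfl
    rw [map_zero] at hP
    exact hx₁ ((c_mul_mem_lattice_iff_of_isOptimal D₁ hD₁ x).mp ((gamma1_uniformize_eq_zero_iff D₁ _).mp hP.symm))

/-- **E-an-235 (PROVED ⟸ F★): a Shimura `p`-kernel (`¬ ShimuraIndexPrimeTo p f`, i.e. `p ∣ #(Λ₀(f)/Λ₁(f))`) forces a rational point
of order `p` on the `X₁(N)`-optimal curve.**  Compare E-an-128ℓ (`shimuraOddPrimeForcesRationalTorsion_of_cuspGalois`: the same conclusion on
the `X₀(N)`-optimal curve needs F★₀ ∧ F★ ∧ F♮ ∧ CES). [cite: Vatsal2005, Rem. 1.8] [cite: Stevens1989, §2] -/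
theorem exists_addOrderOf_eq_of_not_shimuraIndexPrimeTo (hF : optimalGamma1Parametrization_cusp_rational)
    (D₁ : Gamma1ParametrizationData W₁ N) (hD₁ : D₁.IsOptimal) {p : ℕ} (hp : p.Prime) (hS : ¬ ShimuraIndexPrimeTo p D₁.f) :
    ∃ P : (W₁.baseChange ℚ).toAffine.Point, addOrderOf P = p := by
  simp only [ShimuraIndexPrimeTo, not_forall, exists_prop] at hS
  obtain ⟨x, hx, hpx, hx₁⟩ := hS
  obtain ⟨P, -, hP⟩ := exists_addOrderOf_eq_of_mem_periodLattice hF D₁ hD₁ hp hx hpx hx₁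
  exact ⟨P, hP⟩

end StevensCurve

section Class

/-- **E-an-235 PROVED ⟸ F★ ∧ CES.**  CES supplies Stevens' curve `W₁` with an optimal `X₁(N)`-datum, of the same newform by multiplicity one
(`IsNewformOf.unique`, `IsNewformOf.of_isIsogenous`); then `exists_addOrderOf_eq_of_not_shimuraIndexPrimeTo`.
[cite: Vatsal2005, Rem. 1.8] [cite: ConradEdixhovenStein2003, Thm. 1.1.3] -/
theorem shimuraKernelForcesClassTorsion_of_cuspRational (hF : optimalGamma1Parametrization_cusp_rational)
    (hex : exists_optimal_gamma1ParametrizationData) : ShimuraKernelForcesClassTorsion := by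
  intro W₀ _ _ N _ D₀ hopt p hp hS
  obtain ⟨W₁, _, _, D₁, hiso, hD₁⟩ := hex W₀ D₀ hopt
  have hf : D₁.f = D₀.f := D₁.isNewformOf.unique (D₀.isNewformOf.of_isIsogenous hiso)
  rw [← hf] at hS
  exact ⟨W₁, ‹_›, hiso, exists_addOrderOf_eq_of_not_shimuraIndexPrimeTo hF D₁ hD₁ hp hS⟩

end Class

/-! ### §3. E-an-225 ⟸ F★ ∧ CES ∧ E-an-234 (PROVED) -/

/-- **The `μ`-type node E-an-225 from print plus the algebra node (PROVED edge):**
`F★ → CES → ShimuraCoverKernelGivesMuThree → ShimuraThreeKernelHasMuThree`.  CES supplies Stevens' curve `W₁` with an optimal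
`X₁(N)`-datum of the same newform (multiplicity one), §1 makes every kernel point of the Shimura cover rational (F★), and E-an-234 turns the
rational kernel point of order `3` into `μ₃ ⊂ W₀`. [cite: Vatsal2005, Rem. 1.8] [cite: ConradEdixhovenStein2003, Thm. 1.1.3, §6.1.2, §6.2] -/
theorem shimuraThreeKernelHasMuThree_of_cover (hF : optimalGamma1Parametrization_cusp_rational)
    (hex : exists_optimal_gamma1ParametrizationData) (h234 : ShimuraCoverKernelGivesMuThree) :
    ShimuraThreeKernelHasMuThree := by
  intro W₀ _ _ N _ D₀ hopt hS
  obtain ⟨W₁, _, _, D₁, hiso, hD₁⟩ := hex W₀ D₀ hopt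
  have hf : D₁.f = D₀.f := D₁.isNewformOf.unique (D₀.isNewformOf.of_isIsogenous hiso)
  have hS' := hS
  simp only [ShimuraIndexPrimeTo, not_forall, exists_prop] at hS'
  obtain ⟨x, hx, h3x, hx₁⟩ := hS'
  have hx' : x ∈ periodLattice D₁.f := hf ▸ hx
  have h3x' : ((3 : ℕ) : ℂ) * x ∈ periodLatticeGamma1 D₁.f := by rw [hf]; exact_mod_cast h3x
  have hx₁' : x ∉ periodLatticeGamma1 D₁.f := hf ▸ hx₁
  obtain ⟨P, hP, hP3⟩ := exists_addOrderOf_eq_of_mem_periodLattice hF D₁ hD₁ Nat.prime_three hx' h3x' hx₁'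
  refine h234 W₀ W₁ D₀ D₁ hf hopt hD₁ (fun y hy ↦ ?_) x P hx h3x hP hP3
  rw [← hf] at hy
  exact exists_rational_eq_uniformize_of_mem_periodLattice hF D₁ hD₁ hy

/-! ### §4. Ladder consequences (PROVED edges): the rung E-an-222ₒ from ONE empirical law + E-an-234 + print -/

/-- **E-an-222ₒ ⟸ E-an-223 ∧ E-an-234 ∧ {F★₀, F★, F♮, CES} (PROVED).**  «No Shimura `3`-kernel for a lattice-optimal minimal `W` at
`3 ∣ N`, `27 ∤ N`» follows from the cell's EMPIRICAL Hesse-optimality law E-an-223 (`HesseNotOptimalAtTameThree`, 0/852), the algebra node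
E-an-234, and four REGISTERED PRINTED facts: F★₀ (`optimalParametrization_cuspZero_rational`), F★, F♮
(`optimalGamma1Parametrization_cuspZero_galoisConjugate`), CES — via E-an-128 ⟸ print (an g41 Θ file,
`shimuraThreeForcesRationalThreeTorsion_of_cuspGalois`) and `shimuraThreeKernelForcesTwentySevenOpt_of_hesse`.  The empirical sign law
E-es-72 is NOT needed on this road. [cite: Vatsal2005, Rem. 1.8] [cite: Stevens1982, Thm. 1.3.1] -/
theorem shimuraThreeKernelForcesTwentySevenOpt_of_cover (h223 : HesseNotOptimalAtTameThree)
    (hF₀ : optimalParametrization_cuspZero_rational) (hF : optimalGamma1Parametrization_cusp_rational)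
    (hB : optimalGamma1Parametrization_cuspZero_galoisConjugate) (hex : exists_optimal_gamma1ParametrizationData)
    (h234 : ShimuraCoverKernelGivesMuThree) : ShimuraThreeKernelForcesTwentySevenOpt :=
  shimuraThreeKernelForcesTwentySevenOpt_of_hesse h223 (shimuraThreeForcesRationalThreeTorsion_of_cuspGalois hB hF₀ hF hex)
    (shimuraThreeKernelHasMuThree_of_cover hF hex h234)

/-- **es's plus-index law E-es-67♮ ⟸ F★ ∧ CES ∧ E-an-234 (PROVED, by name through E-an-225).** [cite: Vatsal2005, Rem. 1.8] -/
theorem plusIndexPrimeToThreeOfNoMuThree_of_cover (hF : optimalGamma1Parametrization_cusp_rational)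
    (hex : exists_optimal_gamma1ParametrizationData) (h234 : ShimuraCoverKernelGivesMuThree) :
    PlusIndexPrimeToThreeOfNoMuThree :=
  plusIndexPrimeToThreeOfNoMuThree_of_muType (shimuraThreeKernelHasMuThree_of_cover hF hex h234)

end Summit.BirchSwinnertonDyer.Rank1Residual.ManinAdditive.ShimuraCover
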